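import Literature.Barriers.Schanuel.NesterenkoModularScope
import Literature.NumberTheory.Transcendental.NesterenkoElimination
import Mathlib.Analysis.SpecialFunctions.Pow.Real
import HarnessLib

/-!
# Barrier (Schanuel) `NesterenkoModularScope`: the measure of algebraic independence, LNM 1752 Ch. 3 Theorem 5.1 (named fact)

`Literature/Barriers/Schanuel/NesterenkoModularScopeMeasure.lean`. Ch. 3 §5 of LNM 1752 ("Another
proof of Theorem 1.1") deduces Theorem 1.1 (`nesterenko1996_thm_1_1`, the barrier declaration
`NesterenkoModularScope`) from the following quantitative statement about the point
`ω̄ = (1, q, P(q), Q(q), R(q)) ∈ ℂ⁵` and Nesterenko's invariants `deg I`, `h(I)`, `|I(ω̄)|` of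
homogeneous unmixed ideals `I ⊂ ℚ[x₀, …, x₄]`
(`Literature/NumberTheory/Transcendental/NesterenkoElimination.lean`):

  THEOREM 5.1. Let `q ∈ ℂ`, `0 < |q| < 1`. Then for each integer `r`, `1 ≤ r ≤ 3`, there exists a
  constant `μ_r > 0` such that for any homogeneous unmixed ideal `I ⊂ ℚ[x₀, …, x₄]`,
  `dim I = r − 1`, the following inequality holds:
  `log |I(ω̄)| ≥ −μ_r T^{4/(4−r)} (log T)^{8r/(4−r)}`, where `T` is an arbitrary number satisfying
  `T ≥ max{h(I) + deg I, e}`, and `ω̄ = (1, q, P(q), Q(q), R(q)) ∈ ℂ⁵`.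

(= the main theorem of [Nes10]; Corollary 5.2 is the measure of algebraic independence of
`π, e^π, Γ(1/4)`.) It is vendored here as the named fact `NesterenkoPhilippon2001_ch3_thm_5_1`
(nothing asserted), with `ω̄ = nesterenkoOmega q`. The sibling proofs files prove

* `NesterenkoModularScopeMeasureProofs.lean`: Theorem 1.1 from Theorem 5.1 and Corollary 4.10
  (the deduction printed on p. 42), `nesterenko1996_thm_1_1_of_thm_5_1`;
* (planned) Theorem 5.1 itself from Lemma 2.2 (`NesterenkoPhilippon2001_ch3_lemma_2_2`) and the
  §4 toolkit facts of `NesterenkoEliminationFacts.lean`, by the induction on `r` of pp. 42–46.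

## References

* [NesterenkoPhilippon2001] LNM 1752 (2001), Ch. 3 (Yu. V. Nesterenko) §5 Theorem 5.1
  (pp. 41–42 = PDF pp. 53–54), Corollary 5.2 (p. 46).
* [Nes10] Yu. V. Nesterenko, Proc. Steklov Inst. Math. 218 (1997) 294–331 (the original).
-/

noncomputable section

open Complex MvPolynomial
open Literature.NumberTheory.Transcendental Literature.NumberTheory.Transcendental.Nesterenko

attribute [local instance] MvPolynomial.gradedAlgebra

namespace Literature.Barriers.Schanuel

/-- The point `ω̄ = (1, q, P(q), Q(q), R(q)) ∈ ℂ⁵` of Ch. 3 §5 (projective coordinates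
`x₀, …, x₄`; `ramanujanPoint q` is `(q, P(q), Q(q), R(q))`).
[cite: NesterenkoPhilippon2001, Ch. 3 Theorem 5.1 (p. 42)] -/
def nesterenkoOmega (q : ℂ) : Fin 5 → ℂ :=
  ![1, q, ramanujanP q, ramanujanQ q, ramanujanR q]

/-- `ω₀ = 1`. [folklore] -/
@[simp] theorem nesterenkoOmega_zero (q : ℂ) : nesterenkoOmega q 0 = 1 := rfl

/-- `ω̄ ≠ 0`. [folklore] -/
theorem nesterenkoOmega_ne_zero (q : ℂ) : nesterenkoOmega q ≠ 0 := fun h => by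
  simpa using congrFun h 0

/-- The affine coordinates `ω₁, …, ω₄` are `q, P(q), Q(q), R(q)`. [folklore] -/
theorem range_nesterenkoOmega (q : ℂ) :
    Set.range (nesterenkoOmega q) = {1, q, ramanujanP q, ramanujanQ q, ramanujanR q} := by
  ext w
  simp only [Set.mem_range, Set.mem_insert_iff, Set.mem_singleton_iff]
  constructor
  · rintro ⟨i, rfl⟩
    fin_cases i <;> simp [nesterenkoOmega]
  · rintro (rfl | rfl | rfl | rfl | rfl)
    exacts [⟨0, rfl⟩, ⟨1, rfl⟩, ⟨2, rfl⟩, ⟨3, rfl⟩, ⟨4, rfl⟩]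

/-- **LNM 1752 Ch. 3 Theorem 5.1** (Nesterenko's measure; = [Nes10] main theorem): for `q ∈ ℂ`,
`0 < |q| < 1`, and each `r ∈ {1, 2, 3}` there is `μ_r > 0` such that for every homogeneous
unmixed ideal `I ⊂ ℚ[x₀, …, x₄]` with `dim I = r − 1` and every real `T ≥ max{h(I) + deg I, e}`,
`log |I(ω̄)| ≥ −μ_r T^{4/(4−r)} (log T)^{8r/(4−r)}`, `ω̄ = (1, q, P(q), Q(q), R(q))` (stated as
`|I(ω̄)| ≥ exp(−μ_r T^{4/(4−r)} (log T)^{8r/(4−r)})`). Users take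
`(h : NesterenkoPhilippon2001_ch3_thm_5_1)`.
[cite: NesterenkoPhilippon2001, Ch. 3 Theorem 5.1 (pp. 41–42)] -/
def NesterenkoPhilippon2001_ch3_thm_5_1 : Prop :=
  ∀ q : ℂ, 0 < ‖q‖ → ‖q‖ < 1 → ∀ r : ℕ, 1 ≤ r → r ≤ 3 → ∃ μ : ℝ, 0 < μ ∧
    ∀ I : Ideal (Rx 4), I.IsHomogeneous (homogeneousSubmodule (Fin 5) ℚ) → IsUnmixedOfRank I r →
      ∀ T : ℝ, max (iheight I r + ideg I r) (Real.exp 1) ≤ T →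
        Real.exp (-(μ * T ^ ((4 : ℝ) / (4 - r)) * Real.log T ^ ((8 : ℝ) * r / (4 - r)))) ≤
          iabs I r (nesterenkoOmega q)

end Literature.Barriers.Schanuel

end
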